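import Summits.QuantumFields.BalabanUV.Beta.FP.CoarseCovarianceStripPropCone
import Summits.QuantumFields.BalabanUV.Beta.FP.CoarseCovarianceStripAliasWeights

/-!
# `BalabanUV.Beta.FP.CoarseCovarianceStripAlias` — road «FP» (binder row D1), row H′2-IR ∕ IR-2 (ii), file (Alias): **EVERY ALIAS MOMENTUM
# `k_l = (k + 2πl)/n`, `l ≠ 0`, OF A FAT-REGION COARSE MOMENTUM LIES IN THE CONE REGION OF FILE (A)** (so `‖PC(k_l)‖ ≤ CP·n²`), the `l = 0`
# contour weight is two-sided `≍ n^{D+1}` on the fat region, and the `l ≠ 0` MAJORANT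
# `Σ_{l≠0} ‖cweight n κ (k_l)·cweight n λ (−k_l)·PC(k_l)_{κλ}‖ ≤ CA(d)·n^{2D+4}` holds on the whole fat region `Fat D (rA d)`

HONEST FRAMING (cell contract, verbatim): «discharging `BetaPertH` makes Bałaban's UV stability UNCONDITIONAL — a real constructive-QFT
result; it is NOT the continuum limit and NOT the Clay problem.»  HONEST DEPENDENCY (verbatim): «continuum YM on T⁴ ⇐ BetaPertH ∧ nine
spine estimates (0/9 proved); BetaPertH ⇐ (D1) ∧ (D4) ∧ CAP+tail; G-an2-4 gates asym, D1 and NE2/3/4.»  THIS MODULE DISCHARGES NOTHING of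
D1 ∕ BetaPertH: [folklore] trigonometric bookkeeping over t4-ne9-formalise-leaf-04-g35's slice (Alias-W) `CoarseCovarianceStripAliasWeights` BY NAME
(`cweight_alias_mul_cweight_neg_of_mem_fat`: `cweight·cweight(−) = n^{2D}·U·gsum·gsum(−)`; `aliasPt_im`; `norm_gsum_aliasPt_zero_ge`: the `l = 0`
geometric sum is `≥ (3/16)e^{−2r}n` on the fat box), B4's residue sum `B4StripCauchy.sum_norm_U_le` (`Σ_l ‖U n l k‖ ≤ 132^D`) and the cone
theorem `CoarseCovarianceStripPropCone.PC_bound_cone` BY NAME.  Two [our object] CONSTANT defs (`rA`, `CA`, `d`-only); no `def … : Prop`; nothing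
is cited; 0 sorry.  NOT summit progress; NOT BetaPertH, NOT continuum, NOT Clay.

ABSOLUTE RULE (cell, verbatim): «No internally-minted statement may enter as a cited fact. Every hypothesis is either kernel-proved in this
package or a verbatim quotation of a PUBLISHED theorem with page reference. The manuscript(s) under audit are NOT citable for their own
disputed steps — they are the thing under adjudication; programme-internal (2001/route/tribunal) claims are never citable.»

CONTENT (`D = d+1`; INTENT journal l.22234 ∕ gen-8 ONLINE l.22857; owner design memo `HOME/b2b-balaban-beta-d1-p3/H2IR-DESIGN.md` §IR-2 (ii)).
* §2 `aliasPt_re`, `aliasPt_zero_apply`.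
* §3 sizes: `norm_gsum_alias_le`∕`_neg_` (`≤ n·e^{|Im k_i|}`), `norm_cweight_alias_le`∕`_neg_` (`≤ (n e^{2r})^{D+1}` on `Fat D r`),
  **`norm_cweight_aliasZero_ge`** (the `l = 0` weight is `≥ ((3/16)e^{−2r}n)^{D+1}`), `cweight_aliasZero_ne_zero`, and the reflected twins
  `neg_mem_Fat`, `neg_aliasPt_zero`, `norm_cweight_neg_aliasZero_ge`, `cweight_neg_aliasZero_ne_zero`.
* §4 geometry: `abs_toIocMod_ge`, **`redist_alias_ge`** (`(π − r)/n ≤ redist (k_l)`, `l ≠ 0`), the alias radius `rA d := min (κ₀/2) c₁`,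
  **`alias_cone`** (every `k_l`, `l ≠ 0`, of `k ∈ Fat D rA` satisfies the hypotheses of `PC_bound_cone`), **`PC_alias_bound`** (`‖PC (k_l) α β‖ ≤ CP·n²`).
* §5 `norm_alias_term_le`, **`sum_alias_norm_le`** — THE `l ≠ 0` MAJORANT `≤ CA d·n^{2D+4}`, `CA d := e^{4 rA}·CP·132^D`.
Unit `b2b-balaban-beta-d1-formalise-leaf-06` (gen 8), owner ruling R-FP-21 (A3)∕(C); (Alias-W) owner GO l.22907 (3).
-/

noncomputable section

namespace Summit.QuantumFields.BalabanUV.Beta.FP.CoarseCovarianceStripAlias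

open Finset Complex Set Metric Matrix
open scoped BigOperators ComplexConjugate
open Literature.MathematicalPhysics.QuantumFieldTheory.Balaban1983to89
open B4Strip (Strip ofRealVec reVec S1 Sxi uFactor U)
open B4StripCauchy (Fat sum_norm_U_le)
open Summit.QuantumFields.BalabanUV.Beta.GAN24.FibreSymbols (gsum)
open Summit.QuantumFields.BalabanUV.Beta.GAN24.AliasDecimate (aliasPt)
open Summit.QuantumFields.BalabanUV.Beta.GAN24.PushSumSymbol (cweight)
open Summit.QuantumFields.BalabanUV.Beta.GAN24.AliasStripSymbolsSum (norm_gsum_le_of_im)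
open Summit.QuantumFields.BalabanUV.Beta.FP.CoarseCovarianceStripW
open Summit.QuantumFields.BalabanUV.Beta.FP.CoarseCovarianceStripFeyn
open Summit.QuantumFields.BalabanUV.Beta.FP.CoarseCovarianceStripProp
open Summit.QuantumFields.BalabanUV.Beta.FP.CoarseCovarianceStripPropCone
open Summit.QuantumFields.BalabanUV.Beta.FP.CoarseCovarianceStripAliasWeights

variable {d : ℕ}

/-! ## §2 The alias points of a fat coarse momentum -/

/-- [folklore] real part of an alias coordinate. -/
theorem aliasPt_re (n : ℕ) (l : Fin (d + 1) → Fin n) (k : Fin (d + 1) → ℂ) (i : Fin (d + 1)) :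
    (aliasPt n l k i).re = ((k i).re + 2 * Real.pi * ((l i : ℕ) : ℝ)) / n := by
  rw [aliasPt_apply', show (n : ℂ) = ((n : ℝ) : ℂ) by norm_cast, Complex.div_ofReal_re]
  congr 1
  simp

/-- [folklore] the `l = 0` alias point is `k/n`. -/
theorem aliasPt_zero_apply (n : ℕ) [NeZero n] (k : Fin (d + 1) → ℂ) (i : Fin (d + 1)) :
    aliasPt n (fun _ => (0 : Fin n)) k i = k i / n := by
  simp [aliasPt_apply']

/-! ## §3 Sizes of the weights -/

/-- [folklore] `‖gsum ((k_l)_i) n‖ ≤ n·e^{|Im k_i|}`. -/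
theorem norm_gsum_alias_le (n : ℕ) [NeZero n] (l : Fin (d + 1) → Fin n) (k : Fin (d + 1) → ℂ) (i : Fin (d + 1)) :
    ‖gsum (aliasPt n l k i) n‖ ≤ n * Real.exp |(k i).im| := by
  refine norm_gsum_le_of_im _ _ (le_of_eq ?_)
  have hn : (n : ℝ) ≠ 0 := Nat.cast_ne_zero.mpr (NeZero.ne n)
  rw [aliasPt_im, abs_div, Nat.abs_cast, div_mul_cancel₀ _ hn]

/-- [folklore] `‖gsum (−(k_l)_i) n‖ ≤ n·e^{|Im k_i|}`. -/
theorem norm_gsum_neg_alias_le (n : ℕ) [NeZero n] (l : Fin (d + 1) → Fin n) (k : Fin (d + 1) → ℂ) (i : Fin (d + 1)) :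
    ‖gsum (-(aliasPt n l k i)) n‖ ≤ n * Real.exp |(k i).im| := by
  refine norm_gsum_le_of_im _ _ (le_of_eq ?_)
  have hn : (n : ℝ) ≠ 0 := Nat.cast_ne_zero.mpr (NeZero.ne n)
  rw [Complex.neg_im, abs_neg, aliasPt_im, abs_div, Nat.abs_cast, div_mul_cancel₀ _ hn]

/-- [folklore] `‖cweight n κ (k_l)‖ ≤ (n·e^{2r})^{D+1}` for `k ∈ Fat D r`. -/
theorem norm_cweight_alias_le (n : ℕ) [NeZero n] {r : ℝ} {k : Fin (d + 1) → ℂ} (hk : k ∈ Fat (d + 1) r)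
    (l : Fin (d + 1) → Fin n) (κ : Fin (d + 1)) : ‖cweight n κ (aliasPt n l k)‖ ≤ (n * Real.exp (2 * r)) ^ (d + 2) := by
  have hfac : ∀ i, ‖gsum (aliasPt n l k i) n‖ ≤ n * Real.exp (2 * r) := fun i =>
    (norm_gsum_alias_le n l k i).trans (mul_le_mul_of_nonneg_left (Real.exp_le_exp.mpr (hk i).2) (Nat.cast_nonneg n))
  unfold cweight
  rw [norm_mul, norm_prod, pow_succ]
  refine mul_le_mul ?_ (hfac κ) (norm_nonneg _) (by positivity)
  calc ∏ i, ‖gsum (aliasPt n l k i) n‖ ≤ ∏ _i : Fin (d + 1), (n * Real.exp (2 * r)) :=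
        Finset.prod_le_prod (fun i _ => norm_nonneg _) fun i _ => hfac i
    _ = (n * Real.exp (2 * r)) ^ (d + 1) := by simp

/-- [folklore] `‖cweight n λ (−k_l)‖ ≤ (n·e^{2r})^{D+1}` for `k ∈ Fat D r`. -/
theorem norm_cweight_neg_alias_le (n : ℕ) [NeZero n] {r : ℝ} {k : Fin (d + 1) → ℂ} (hk : k ∈ Fat (d + 1) r)
    (l : Fin (d + 1) → Fin n) (lam : Fin (d + 1)) : ‖cweight n lam (-aliasPt n l k)‖ ≤ (n * Real.exp (2 * r)) ^ (d + 2) := by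
  have hfac : ∀ i, ‖gsum ((-aliasPt n l k) i) n‖ ≤ n * Real.exp (2 * r) := fun i => by
    rw [Pi.neg_apply]
    exact (norm_gsum_neg_alias_le n l k i).trans (mul_le_mul_of_nonneg_left (Real.exp_le_exp.mpr (hk i).2) (Nat.cast_nonneg n))
  unfold cweight
  rw [norm_mul, norm_prod, pow_succ]
  refine mul_le_mul ?_ (hfac lam) (norm_nonneg _) (by positivity)
  calc ∏ i, ‖gsum ((-aliasPt n l k) i) n‖ ≤ ∏ _i : Fin (d + 1), (n * Real.exp (2 * r)) :=
        Finset.prod_le_prod (fun i _ => norm_nonneg _) fun i _ => hfac i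
    _ = (n * Real.exp (2 * r)) ^ (d + 1) := by simp

/-- [our object] **THE `l = 0` CONTOUR WEIGHT IS LARGE ON THE FAT REGION**: `((3/16)e^{−2r}n)^{D+1} ≤ ‖cweight n κ (k/n)‖`, `k ∈ Fat D r`, `r ≤ 1/4`. -/
theorem norm_cweight_aliasZero_ge (n : ℕ) [NeZero n] {r : ℝ} (hr : r ≤ 1 / 4) {k : Fin (d + 1) → ℂ} (hk : k ∈ Fat (d + 1) r)
    (κ : Fin (d + 1)) : (3 / 16 * Real.exp (-(2 * r)) * n) ^ (d + 2) ≤ ‖cweight n κ (aliasPt n (fun _ => (0 : Fin n)) k)‖ := by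
  have hfac : ∀ i, 3 / 16 * Real.exp (-(2 * r)) * n ≤ ‖gsum (aliasPt n (fun _ => (0 : Fin n)) k i) n‖ := fun i =>
    norm_gsum_aliasPt_zero_ge hr hk i
  have h0 : 0 ≤ 3 / 16 * Real.exp (-(2 * r)) * n := by positivity
  unfold cweight
  rw [norm_mul, norm_prod, pow_succ]
  refine mul_le_mul ?_ (hfac κ) h0 (Finset.prod_nonneg fun i _ => norm_nonneg _)
  calc (3 / 16 * Real.exp (-(2 * r)) * n) ^ (d + 1) = ∏ _i : Fin (d + 1), (3 / 16 * Real.exp (-(2 * r)) * n) := by simp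
    _ ≤ ∏ i, ‖gsum (aliasPt n (fun _ => (0 : Fin n)) k i) n‖ := Finset.prod_le_prod (fun i _ => h0) fun i _ => hfac i

/-- [folklore] hence the `l = 0` contour weight does not vanish on the fat region. -/
theorem cweight_aliasZero_ne_zero (n : ℕ) [NeZero n] {r : ℝ} (hr : r ≤ 1 / 4) {k : Fin (d + 1) → ℂ} (hk : k ∈ Fat (d + 1) r)
    (κ : Fin (d + 1)) : cweight n κ (aliasPt n (fun _ => (0 : Fin n)) k) ≠ 0 := by
  have hn0 : (0 : ℝ) < n := by exact_mod_cast Nat.pos_of_ne_zero (NeZero.ne n)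
  have h := norm_cweight_aliasZero_ge n hr hk κ
  have hpos : 0 < (3 / 16 * Real.exp (-(2 * r)) * n) ^ (d + 2) := by positivity
  intro h0
  rw [h0, norm_zero] at h
  linarith

/-- [folklore] the fat region is symmetric under `k ↦ −k`. -/
theorem neg_mem_Fat {r : ℝ} {k : Fin (d + 1) → ℂ} (hk : k ∈ Fat (d + 1) r) : -k ∈ Fat (d + 1) r := fun i => by
  have h := hk i
  simp only [Pi.neg_apply, Complex.neg_re, Complex.neg_im, abs_neg]
  exact h

/-- [folklore] `−(k/n) = (−k)/n`: the reflected `l = 0` alias point is the `l = 0` alias point of `−k`. -/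
theorem neg_aliasPt_zero (n : ℕ) [NeZero n] (k : Fin (d + 1) → ℂ) :
    -aliasPt n (fun _ => (0 : Fin n)) k = aliasPt n (fun _ => (0 : Fin n)) (-k) := by
  funext i
  simp [aliasPt_apply', neg_div]

/-- [our object] the reflected `l = 0` contour weight is large too: `((3/16)e^{−2r}n)^{D+1} ≤ ‖cweight n λ (−k/n)‖`, `k ∈ Fat D r`, `r ≤ 1/4`. -/
theorem norm_cweight_neg_aliasZero_ge (n : ℕ) [NeZero n] {r : ℝ} (hr : r ≤ 1 / 4) {k : Fin (d + 1) → ℂ} (hk : k ∈ Fat (d + 1) r)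
    (lam : Fin (d + 1)) : (3 / 16 * Real.exp (-(2 * r)) * n) ^ (d + 2) ≤ ‖cweight n lam (-aliasPt n (fun _ => (0 : Fin n)) k)‖ := by
  rw [neg_aliasPt_zero]
  exact norm_cweight_aliasZero_ge n hr (neg_mem_Fat hk) lam

/-- [folklore] hence the reflected `l = 0` contour weight does not vanish on the fat region. -/
theorem cweight_neg_aliasZero_ne_zero (n : ℕ) [NeZero n] {r : ℝ} (hr : r ≤ 1 / 4) {k : Fin (d + 1) → ℂ} (hk : k ∈ Fat (d + 1) r)
    (lam : Fin (d + 1)) : cweight n lam (-aliasPt n (fun _ => (0 : Fin n)) k) ≠ 0 := by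
  rw [neg_aliasPt_zero]
  exact cweight_aliasZero_ne_zero n hr (neg_mem_Fat hk) lam

/-! ## §4 Geometry: the alias points `l ≠ 0` lie in the cone region -/

/-- [folklore] a real number in `[a, 2π − a]` reduces modulo `2π` into `(−π, π]` to something of absolute value `≥ a`. -/
theorem abs_toIocMod_ge {a x : ℝ} (ha : a ≤ x) (hx : x ≤ 2 * Real.pi - a) : a ≤ |toIocMod Real.two_pi_pos (-Real.pi) x| := by
  rw [toIocMod]
  set m : ℤ := toIocDiv Real.two_pi_pos (-Real.pi) x
  rw [zsmul_eq_mul]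
  have hπ := Real.pi_pos
  rcases le_or_gt m 0 with hm | hm
  · have hm' : (m : ℝ) ≤ 0 := by exact_mod_cast hm
    have h1 : a ≤ x - m * (2 * Real.pi) := by nlinarith
    exact h1.trans (le_abs_self _)
  · have hm' : (1 : ℝ) ≤ m := by exact_mod_cast hm
    have h1 : a ≤ -(x - m * (2 * Real.pi)) := by nlinarith
    exact h1.trans (neg_le_abs _)

/-- [our object] **THE ALIAS POINTS `l ≠ 0` STAY AWAY FROM `2πℤ^D`**: for `k ∈ Fat D r` and `l ≠ 0`, `(π − r)/n ≤ redist (k_l)`. -/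
theorem redist_alias_ge (n : ℕ) [NeZero n] {r : ℝ} {k : Fin (d + 1) → ℂ} (hk : k ∈ Fat (d + 1) r)
    {l : Fin (d + 1) → Fin n} (hl : l ≠ fun _ => 0) : (Real.pi - r) / n ≤ redist (aliasPt n l k) := by
  obtain ⟨i, hi⟩ : ∃ i, l i ≠ 0 := by
    by_contra h
    push Not at h
    exact hl (funext h)
  have hj1 : (1 : ℝ) ≤ ((l i : ℕ) : ℝ) := by
    have : (l i : ℕ) ≠ 0 := fun h => hi (Fin.ext h)
    exact_mod_cast Nat.one_le_iff_ne_zero.mpr this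
  have hjn : ((l i : ℕ) : ℝ) + 1 ≤ n := by exact_mod_cast (l i).isLt
  have hn0 : (0 : ℝ) < n := by exact_mod_cast Nat.pos_of_ne_zero (NeZero.ne n)
  have hπ := Real.pi_pos
  have hre := abs_le.mp (hk i).1
  refine le_trans ?_ (abs_re_wrapC_le (aliasPt n l k) i)
  rw [wrapC_apply, wrapRe_re, aliasPt_re]
  apply abs_toIocMod_ge
  · rw [div_le_div_iff_of_pos_right hn0]
    nlinarith
  · rw [div_le_iff₀ hn0, sub_mul, div_mul_cancel₀ _ hn0.ne']
    nlinarith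

/-- [our object] the alias radius `rA := min (κ₀/2) c₁` (`κ₀ = kap0 d`, `c₁ = cone d` of file (A)). -/
def rA (d : ℕ) : ℝ := min (kap0 d / 2) (cone d)

/-- [folklore] `0 < rA ≤ 1/4`, `2·rA ≤ κ₀`, `rA ≤ c₁`, `rA ≤ r_F`. -/
theorem rA_pos (d : ℕ) : 0 < rA d := lt_min (by linarith [kap0_pos d]) (cone_pos d)

/-- [folklore] `rA ≤ c₁`. -/
theorem rA_le_cone (d : ℕ) : rA d ≤ cone d := min_le_right _ _

/-- [folklore] `rA ≤ 1/4`. -/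
theorem rA_le_quarter (d : ℕ) : rA d ≤ 1 / 4 := (rA_le_cone d).trans (cone_le_quarter d)

/-- [folklore] `2·rA ≤ κ₀`. -/
theorem two_rA_le_kap0 (d : ℕ) : 2 * rA d ≤ kap0 d := by have := min_le_left (kap0 d / 2) (cone d); unfold rA; linarith

/-- [folklore] `rA ≤ r_F`. -/
theorem rA_le_rF (d : ℕ) : rA d ≤ rF d := by linarith [two_rA_le_kap0 d, kap0_le_rF d, rA_pos d]

/-- [our object] **EVERY ALIAS POINT `l ≠ 0` OF A FAT COARSE MOMENTUM IS IN THE CONE REGION OF FILE (A)**: for `k ∈ Fat D rA` and `l ≠ 0`,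
`|Im (k_l)_i| ≤ κ₀` and `|Im (k_l)_i| ≤ c₁·redist (k_l)` for every `i`. -/
theorem alias_cone (n : ℕ) [NeZero n] {k : Fin (d + 1) → ℂ} (hk : k ∈ Fat (d + 1) (rA d)) {l : Fin (d + 1) → Fin n}
    (hl : l ≠ fun _ => 0) (i : Fin (d + 1)) :
    |(aliasPt n l k i).im| ≤ kap0 d ∧ |(aliasPt n l k i).im| ≤ cone d * redist (aliasPt n l k) := by
  have hn0 : (0 : ℝ) < n := by exact_mod_cast Nat.pos_of_ne_zero (NeZero.ne n)
  have hn1 : (1 : ℝ) ≤ n := by exact_mod_cast Nat.one_le_iff_ne_zero.mpr (NeZero.ne n)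
  rw [aliasPt_im, abs_div, Nat.abs_cast]
  have h2 : |(k i).im| ≤ 2 * rA d := (hk i).2
  have hred := redist_alias_ge n hk hl
  have hπ := Real.pi_gt_three
  have hc := cone_pos d
  constructor
  · calc |(k i).im| / n ≤ |(k i).im| := div_le_self (abs_nonneg _) hn1
      _ ≤ kap0 d := h2.trans (two_rA_le_kap0 d)
  · have h3 : 2 * rA d ≤ cone d * (Real.pi - rA d) := by
      have := rA_le_cone d; have := rA_le_quarter d
      nlinarith
    calc |(k i).im| / n ≤ 2 * rA d / n := by gcongr
      _ ≤ cone d * (Real.pi - rA d) / n := by gcongr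
      _ = cone d * ((Real.pi - rA d) / n) := by ring
      _ ≤ cone d * redist (aliasPt n l k) := mul_le_mul_of_nonneg_left hred hc.le

/-- [our object] **THE PERFECT PROPAGATOR SYMBOL AT THE ALIAS POINTS `l ≠ 0`**: for `k ∈ Fat D rA` and `l ≠ 0`, `feynC (k_l)` is invertible and
`‖PC (k_l) α β‖ ≤ CP d · n²` (the cone theorem at `redist (k_l) ≥ (π − rA)/n ≥ 1/n`). -/
theorem PC_alias_bound (n : ℕ) [NeZero n] {k : Fin (d + 1) → ℂ} (hk : k ∈ Fat (d + 1) (rA d)) {l : Fin (d + 1) → Fin n}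
    (hl : l ≠ fun _ => 0) : IsUnit (feynC (aliasPt n l k)).det ∧ ∀ α β, ‖PC (aliasPt n l k) α β‖ ≤ CP d * (n : ℝ) ^ 2 := by
  have hn0 : (0 : ℝ) < n := by exact_mod_cast Nat.pos_of_ne_zero (NeZero.ne n)
  have hred := redist_alias_ge n hk hl
  have hπ := Real.pi_gt_three
  have hr4 := rA_le_quarter d
  have hpos : 0 < (Real.pi - rA d) / n := by apply div_pos _ hn0; linarith
  obtain ⟨hU, hb⟩ := PC_bound_cone (fun i => (alias_cone n hk hl i).1) (fun i => (alias_cone n hk hl i).2) (hpos.trans_le hred)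
  refine ⟨hU, fun α β => (hb α β).trans ?_⟩
  have hCP := CP_pos d
  calc CP d / redist (aliasPt n l k) ^ 2 ≤ CP d / ((Real.pi - rA d) / n) ^ 2 :=
        div_le_div_of_nonneg_left hCP.le (by positivity) (pow_le_pow_left₀ hpos.le hred 2)
    _ = CP d * (n : ℝ) ^ 2 / (Real.pi - rA d) ^ 2 := by field_simp
    _ ≤ CP d * (n : ℝ) ^ 2 := div_le_self (by positivity) (by nlinarith)

/-! ## §5 The `l ≠ 0` majorant -/

/-- [our object] the alias constant `CA := e^{4 rA}·CP·132^D`. -/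
def CA (d : ℕ) : ℝ := Real.exp (4 * rA d) * CP d * 132 ^ (d + 1)

/-- [folklore] `0 < CA`. -/
theorem CA_pos (d : ℕ) : 0 < CA d := by unfold CA; have := CP_pos d; positivity

/-- [our object] **ONE ALIAS TERM**: for `k ∈ Fat D rA`, `l ≠ 0`,
`‖cweight n κ (k_l)·cweight n λ (−k_l)·PC (k_l) κ λ‖ ≤ n^{2D+4}·e^{4rA}·CP·‖U n l k‖`. -/
theorem norm_alias_term_le (n : ℕ) [NeZero n] {k : Fin (d + 1) → ℂ} (hk : k ∈ Fat (d + 1) (rA d)) {l : Fin (d + 1) → Fin n}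
    (hl : l ≠ fun _ => 0) (κ lam : Fin (d + 1)) :
    ‖cweight n κ (aliasPt n l k) * cweight n lam (-aliasPt n l k) * PC (aliasPt n l k) κ lam‖
      ≤ (n : ℝ) ^ (2 * (d + 1) + 4) * (Real.exp (4 * rA d) * CP d) * ‖U n l k‖ := by
  have hn0 : (0 : ℝ) ≤ n := Nat.cast_nonneg n
  rw [cweight_alias_mul_cweight_neg_of_mem_fat (rA_le_quarter d) hk κ lam l, norm_mul, norm_mul, norm_mul, norm_mul, norm_pow,
    Complex.norm_natCast]
  have h1 : ‖gsum (aliasPt n l k κ) n‖ ≤ n * Real.exp (2 * rA d) :=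
    (norm_gsum_alias_le n l k κ).trans (mul_le_mul_of_nonneg_left (Real.exp_le_exp.mpr (hk κ).2) hn0)
  have h2 : ‖gsum (-(aliasPt n l k lam)) n‖ ≤ n * Real.exp (2 * rA d) :=
    (norm_gsum_neg_alias_le n l k lam).trans (mul_le_mul_of_nonneg_left (Real.exp_le_exp.mpr (hk lam).2) hn0)
  have h3 : ‖PC (aliasPt n l k) κ lam‖ ≤ CP d * (n : ℝ) ^ 2 := (PC_alias_bound n hk hl).2 κ lam
  have h12 : ‖gsum (aliasPt n l k κ) n‖ * ‖gsum (-(aliasPt n l k lam)) n‖ ≤ (n * Real.exp (2 * rA d)) * (n * Real.exp (2 * rA d)) :=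
    mul_le_mul h1 h2 (norm_nonneg _) (by positivity)
  have hexp : Real.exp (2 * rA d) * Real.exp (2 * rA d) = Real.exp (4 * rA d) := by rw [← Real.exp_add]; ring_nf
  calc (n : ℝ) ^ (2 * (d + 1)) * ‖U n l k‖ * (‖gsum (aliasPt n l k κ) n‖ * ‖gsum (-(aliasPt n l k lam)) n‖) * ‖PC (aliasPt n l k) κ lam‖
      ≤ (n : ℝ) ^ (2 * (d + 1)) * ‖U n l k‖ * ((n * Real.exp (2 * rA d)) * (n * Real.exp (2 * rA d))) * (CP d * (n : ℝ) ^ 2) := by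
        gcongr
    _ = (n : ℝ) ^ (2 * (d + 1) + 4) * (Real.exp (4 * rA d) * CP d) * ‖U n l k‖ := by rw [← hexp]; ring

/-- [our object] **THE `l ≠ 0` MAJORANT**: for every `k ∈ Fat D rA` and every pair of directions,
`Σ_{l ≠ 0} ‖cweight n κ (k_l)·cweight n λ (−k_l)·PC (k_l) κ λ‖ ≤ CA d · n^{2D+4}` (B4's residue sum `Σ_l ‖U n l k‖ ≤ 132^D` BY NAME). -/
theorem sum_alias_norm_le (n : ℕ) [NeZero n] {k : Fin (d + 1) → ℂ} (hk : k ∈ Fat (d + 1) (rA d)) (κ lam : Fin (d + 1)) :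
    ∑ l ∈ Finset.univ.erase (fun _ => (0 : Fin n)),
        ‖cweight n κ (aliasPt n l k) * cweight n lam (-aliasPt n l k) * PC (aliasPt n l k) κ lam‖
      ≤ CA d * (n : ℝ) ^ (2 * (d + 1) + 4) := by
  have hU : ∑ l ∈ Finset.univ.erase (fun _ => (0 : Fin n)), ‖U n l k‖ ≤ 132 ^ (d + 1) := by
    refine le_trans (Finset.sum_le_sum_of_subset_of_nonneg (Finset.erase_subset _ _) fun l _ _ => norm_nonneg _) ?_
    exact sum_norm_U_le n (rA_le_quarter d) hk
  calc ∑ l ∈ Finset.univ.erase (fun _ => (0 : Fin n)),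
          ‖cweight n κ (aliasPt n l k) * cweight n lam (-aliasPt n l k) * PC (aliasPt n l k) κ lam‖
      ≤ ∑ l ∈ Finset.univ.erase (fun _ => (0 : Fin n)), (n : ℝ) ^ (2 * (d + 1) + 4) * (Real.exp (4 * rA d) * CP d) * ‖U n l k‖ :=
        Finset.sum_le_sum fun l hl => norm_alias_term_le n hk (Finset.ne_of_mem_erase hl) κ lam
    _ = (n : ℝ) ^ (2 * (d + 1) + 4) * (Real.exp (4 * rA d) * CP d) * ∑ l ∈ Finset.univ.erase (fun _ => (0 : Fin n)), ‖U n l k‖ := by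
        rw [Finset.mul_sum]
    _ ≤ (n : ℝ) ^ (2 * (d + 1) + 4) * (Real.exp (4 * rA d) * CP d) * 132 ^ (d + 1) := by
        have := CP_pos d
        gcongr
    _ = CA d * (n : ℝ) ^ (2 * (d + 1) + 4) := by unfold CA; ring

end Summit.QuantumFields.BalabanUV.Beta.FP.CoarseCovarianceStripAlias

end
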